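import Literature.AlgebraicGeometry.AbelianSchemes.AbelianSchemeQuotientPolarizationIdentityReduced
import Literature.AlgebraicGeometry.AbelianSchemes.IsLambdaOfAtPullbackWitness
import Literature.AlgebraicGeometry.AbelianSchemes.AbelianSchemeConstSubgroupQuotientKernel
import Literature.AlgebraicGeometry.AbelianSchemes.AbelianSchemeConstSubgroupQuotientSmooth
import Literature.AlgebraicGeometry.AbelianSchemes.IsogenyDivisorClauseBaseChange
import Literature.AlgebraicGeometry.AbelianSchemes.PolarizationUnitHypothesis
import Literature.AlgebraicGeometry.AbelianSchemes.PolarizedAbelianSchemeWithLevel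
import HarnessLib

/-!
# The Hecke quotient triple `(A/K, λ_B, σ_B)` assembled field by field — the `Q`-builder of socket (B)

Generic abelian-scheme algebra over a reduced locally Noetherian base `S` (no moduli).  Given the (ii)-chain datum of a
free finite constant subgroup `K ≤ A(S)` killed by `n` with its dual side `(K′, Φ)` and the universal property `h4` of the
descended rigidified Poincaré sheaf (★ `dualPairOfQuotientRigidified`), a polarisation `pol` of `(A, D)` descending to
`B := A/K` (`hlam` «`λ(K) ⊆ K′`»), and — as INPUTS in their producers' currencies — a polarisation STRUCTURE `polB` of
`(A/K, D_B)` whose morphism is ★ `polarizationDesc` (`hpolB`; its `exists_ample` field is the (X-amp) export), its type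
`htype : polB.HasType δ` (H2c export), the relative dimension `hrel` of `A/K`, and a level-`N` structure `ψφ` on `A/K` with
`ψφ.σ i = σ′_i^n ≫ ψ` symplectic-liftable for `polB` (the (O-lev)/(O-K₀) export), this file ASSEMBLES the typed level-`N`
triple `Q := (A/K, D_B, polB, htype, ψφ, sympl)` and proves the three clauses the socket-(B) assembler
(`Summits/…/Theorems/EquidimHeckeQuotientFamily`, hypothesis `hQ`) consumes about `ψ := quotientMk : A → Q.A`:
(lev) `Q.σ_i = σ′_i^n ≫ ψ`; (ker) at every geometric point the kernel of `ψ` on fibre points is the set of level sections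
indexed by `K₀` (★ `comp_quotientMk_eq_one_iff_of_range`), for any index set `K₀` enumerating `K` through `σ′`;
(pol) the Λ-clause `Λ(ψ_t^* Θ₀) = λ^n` for every witness `Θ₀` of `λ̄_B` (★ export (b)
`comp_polarizationDesc_comp_dualIsogenyOver_eq_comp_mulN` + ★ `IsLambdaOfAt.pullback_pow_witness_of_comp_eq_comp_mulN`).

References: [MumfordAV1970, §23 Thm. 2 p. 231, §7 Thm. 4 p. 72, §15 Thm. 1 p. 143]; [MumfordFogartyKirwan1994, Ch. 7 §3
p. 139 and App. 7A p. 235]; [Milne2005ShimuraVarieties, §6 Thm. 6.11 pp. 74–75].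
-/

noncomputable section

universe u

open CategoryTheory CategoryTheory.Limits AlgebraicGeometry MonoidalCategory CartesianMonoidalCategory
open scoped MonObj

namespace Literature.AlgebraicGeometry.AbelianSchemes

namespace AbelianSchemeOver

open Literature.AlgebraicGeometry.RelativeSpec Literature.AlgebraicGeometry.AbelianVarieties
  Literature.AlgebraicGeometry.Motives Literature.AlgebraicGeometry.Modules

variable {S : Scheme.{u}} [IsReduced S] [IsLocallyNoetherian S] (A : AbelianSchemeOver S)
  {Y : Scheme.{u}} (u : S ⟶ Y) (K : Subgroup A.Sections) [IsCommMonObj A.X] {n : ℕ}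
  (hK : ∀ σ : K, (σ : A.Sections) ^ n = 1)
  [Finite K] [Y.IsSeparated] [IsSeparated (A.X.hom ≫ u)] [S.IsSeparated]
  (hcov : ∀ x : A.left, ∃ O : (A.translationActionOver u K).StableAffineOpens, x ∈ O.1)
  [LocallyOfFiniteType (A.X.hom ≫ u)] [IsLocallyNoetherian Y]
  (hG : ∃ _ : GrpObj (A.quotientOver u K), IsMonHom (A.quotientMk u K hcov))
  (hsm : Smooth (A.quotientOver u K).hom) (hgc : GeometricallyConnected (A.quotientOver u K).hom)
  (D : A.DualPair) [IsAffine Y]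
  (hfree : ∀ (Ω : Type u) [Field Ω] [IsAlgClosed Ω] (x : Spec (.of Ω) ⟶ A.left) (σ : K), σ ≠ 1 →
    x ≫ (A.translation (σ : A.Sections)).left ≠ x)
  (K' : Subgroup D.hat.Sections) [Finite K'] [IsSeparated (D.hat.X.hom ≫ u)]
  (hcov' : ∀ x : D.hat.left, ∃ O : (D.hat.translationActionOver u K').StableAffineOpens, x ∈ O.1)
  [LocallyOfFiniteType (D.hat.X.hom ≫ u)]
  (hG' : ∃ _ : GrpObj (D.hat.quotientOver u K'), IsMonHom (D.hat.quotientMk u K' hcov'))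
  (hsm' : Smooth (D.hat.quotientOver u K').hom) (hgc' : GeometricallyConnected (D.hat.quotientOver u K').hom)
  (hfree' : ∀ (Ω : Type u) [Field Ω] [IsAlgClosed Ω] (x : Spec (.of Ω) ⟶ D.hat.left) (σ : K'), σ ≠ 1 →
    x ≫ (D.hat.translation (σ : D.hat.Sections)).left ≠ x)
  (Φ : (prodTranslationActionOver (A.quotientBy u K hcov hG hsm hgc) D.hat u K' hcov').EquivariantStructure
    (A.poincarePullback u K hK hcov hG hsm hgc D hfree))

/-- **THE HECKE QUOTIENT TRIPLE, ASSEMBLED FIELD BY FIELD, WITH THE THREE SOCKET CLAUSES.**  Inputs (beyond the (ii)-chain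
block): `h4` (D6, universality of the descended Poincaré sheaf), a polarisation `pol` of `(A, D)` with `hlam` («`λ(K) ⊆ K′`»),
a polarisation structure `polB` of `(A/K, D_B)` with `polB.lam = polarizationDesc λ` (`hpolB`; `exists_ample` = (X-amp)) and
`htype : polB.HasType δ` (H2c), `hrel : (A/K).IsOfRelDim g`, a source level structure `σ′` of ANY level `N′` (the Hecke
instance has `N′ = N·n`; this file does not need it), a level-`N` structure `ψφ` of `A/K` with `ψφ.σ i = σ′_i^n ≫ ψ` and
`ψφ.IsSymplecticLiftable polB δ` ((O-lev)/(O-K₀) export, given as the `∃`-statement `hlev`), and an index set `K₀`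
enumerating `K` through `σ′` (`hKr`).  Output: a typed level-`N` triple `Q`
over `S` (namely `(A/K, D_B, polB, htype, ψφ, sympl)`) and `ψ := quotientMk : A → Q.A`, a surjective homomorphism locally
of finite type, with (lev) `Q.σ_i = σ′_i^n ≫ ψ`, (ker) `x ≫ ψ = 1 ↔ x = σ′_c(s̄)` for some `c ∈ K₀` at every geometric point
(★ `comp_quotientMk_eq_one_iff_of_range`), and (pol) `Λ(ψ_t^*Θ₀) = λ^n` for every witness `Θ₀` of `λ̄_B` at `t`
(★ export (b) `comp_polarizationDesc_comp_dualIsogenyOver_eq_comp_mulN`, `hD` from ★ `Polarization.nonempty_unitHatSlice_iso`,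
+ ★ `IsLambdaOfAt.pullback_pow_witness_of_comp_eq_comp_mulN`).
[cite: MumfordAV1970, §23 Thm. 2 (p. 231) and §7 Thm. 4 (p. 72)] [cite: MumfordFogartyKirwan1994, Ch. 7 §3 (p. 139)] -/
theorem exists_quotientTriple_of_fields
    (h4 : ∀ {T : Scheme.{u}} (f : T ⟶ S) (ℒ : (A.quotientBy u K hcov hG hsm hgc).RigidifiedLineBundle f),
      ℒ.FibrewisePicZero →
      ∃! g : {g : T ⟶ (D.hat.quotientBy u K' hcov' hG' hsm' hgc').X.left //
          g ≫ (D.hat.quotientBy u K' hcov' hG' hsm' hgc').X.hom = f},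
        Nonempty ((Scheme.Modules.pullback ((A.quotientBy u K hcov hG hsm hgc).baseChangeToProd
          (D.hat.quotientBy u K' hcov' hG' hsm' hgc') f g.1 g.2)).obj
            (A.poincareQuotRigid u K hK hcov hG hsm hgc D hfree K' hcov' hG' hsm' hgc' Φ) ≅ ℒ.L))
    (pol : A.Polarization D)
    (hlam : ∀ σ : K, A.translation (σ : A.Sections) ≫ pol.lam ≫ D.hat.quotientMk u K' hcov' =
      pol.lam ≫ D.hat.quotientMk u K' hcov')
    (polB : (A.quotientBy u K hcov hG hsm hgc).Polarization
      (A.dualPairOfQuotientRigidified u K hK hcov hG hsm hgc D hfree K' hcov' hG' hsm' hgc' hfree' Φ h4))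
    (hpolB : polB.lam = A.polarizationDesc u K hcov D.hat K' hcov' pol.lam hlam)
    {g : ℕ} {δ : Fin g → ℕ} (htype : polB.HasType δ) (hrel : (A.quotientBy u K hcov hG hsm hgc).IsOfRelDim g)
    {N N' : ℕ} (φ' : A.LevelStructure g N')
    (hlev : letI : GrpObj (A.quotientOver u K) := (A.quotientBy u K hcov hG hsm hgc).grpObj
      ∃ ψφ : (A.quotientBy u K hcov hG hsm hgc).LevelStructure g N,
        (∀ i, ψφ.σ i = (φ'.σ i ^ n) ≫ A.quotientMk u K hcov) ∧ ψφ.IsSymplecticLiftable polB δ)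
    (K₀ : Set (Fin g ⊕ Fin g → ZMod N')) (hKr : ∀ σ : A.Sections, σ ∈ K ↔ ∃ c ∈ K₀, φ'.section_ c = σ) :
    ∃ (Q : PolarizedAbelianSchemeWithLevel g N δ S) (ψ : A.X ⟶ Q.A.X) (_ : IsMonHom ψ) (_ : Surjective ψ.left)
      (_ : LocallyOfFiniteType ψ.left),
      (∀ i, Q.level.σ i = (φ'.σ i ^ n) ≫ ψ) ∧
      (∀ (Ω : Type u) [Field Ω] [IsAlgClosed Ω] (s : Spec (.of Ω) ⟶ S) (x : A.FibrePoints s),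
        x ≫ ψ = 1 ↔ ∃ c ∈ K₀, x = A.restrict s (φ'.section_ c)) ∧
      (∀ (Ω : Type u) [Field Ω] [IsAlgClosed Ω] (t : Spec (.of Ω) ⟶ S)
        (Θ₀ : CartierDivisor (Q.A.fibre t).toAbelianVariety.X.left),
        haveI := isDominant_toSchemeHom_fibreHom ψ t
        Q.A.IsLambdaOfAt t Q.D Q.pol.lam Θ₀ →
          A.IsLambdaOfAt t D (pol.lam ^ n) (Θ₀.pullback (AbelianVariety.Hom.toSchemeHom (fibreHom ψ t)))) := by
  letI : GrpObj (A.quotientOver u K) := (A.quotientBy u K hcov hG hsm hgc).grpObj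
  haveI hψ := A.isMonHom_quotientMk u K hcov hG hsm hgc
  -- the same instance, keyed on the codomain `(A/K).X` (the form ★ `fibreHom`/`isDominant_toSchemeHom_fibreHom` ask for)
  haveI hψ' : @IsMonHom _ _ _ A.X (A.quotientBy u K hcov hG hsm hgc).X _ _ (A.quotientMk u K hcov) := hψ
  obtain ⟨ψφ, hψφ, hsym⟩ := hlev
  haveI : IsFinite (A.quotientMk u K hcov).left := A.isFinite_quotientMk_left u K hcov
  have hlft₀ : LocallyOfFiniteType (A.quotientMk u K hcov).left := inferInstance
  -- `ψ` READ AS A MORPHISM `A.X ⟶ (A/K).X` (the typing the clauses use), with its instances keyed on that typing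
  haveI hsurj : Surjective (show A.X ⟶ (A.quotientBy u K hcov hG hsm hgc).X from A.quotientMk u K hcov).left :=
    A.surjective_quotientMk_left u K hcov
  haveI hlft : LocallyOfFiniteType (show A.X ⟶ (A.quotientBy u K hcov hG hsm hgc).X from A.quotientMk u K hcov).left :=
    hlft₀
  -- the triple `Q := (A/K, D_B, polB, htype, ψφ, sympl)` and `ψ := quotientMk`
  -- (R2⁺ ed. 2) the 8th field `hatNormalised` of the quotient triple: `S` is reduced, so the polarisation gives it
  have hN : Nonempty ((Scheme.Modules.pullback (AbelianSchemeOver.DualPair.unitHatSlice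
      (A.dualPairOfQuotientRigidified u K hK hcov hG hsm hgc D hfree K' hcov' hG' hsm' hgc' hfree' Φ h4))).obj
      (A.dualPairOfQuotientRigidified u K hK hcov hG hsm hgc D hfree K' hcov' hG' hsm' hgc' hfree' Φ h4).P ≅
        SheafOfModules.unit _) :=
    polB.nonempty_unitHatSlice_iso
  refine ⟨⟨A.quotientBy u K hcov hG hsm hgc, hrel,
      A.dualPairOfQuotientRigidified u K hK hcov hG hsm hgc D hfree K' hcov' hG' hsm' hgc' hfree' Φ h4,
      polB, htype, ψφ, hsym, hN⟩, (show A.X ⟶ (A.quotientBy u K hcov hG hsm hgc).X from A.quotientMk u K hcov), hψ', hsurj, hlft, hψφ,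
    fun Ω _ _ s x => ?_,
    fun Ω _ _ t Θ₀ hΘ₀ => ?_⟩
  · -- (ker): ★ `comp_quotientMk_eq_one_iff_of_range`
    exact A.comp_quotientMk_eq_one_iff_of_range u K hcov hG hsm hgc hfree K₀ φ'.section_ (fun σ => hKr σ) s x
  · -- (pol): export (b) + the pulled-back power witness
    haveI := isDominant_toSchemeHom_fibreHom (A' := A) (B := A.quotientBy u K hcov hG hsm hgc)
      (show A.X ⟶ (A.quotientBy u K hcov hG hsm hgc).X from A.quotientMk u K hcov) t
    have hb := A.comp_polarizationDesc_comp_dualIsogenyOver_eq_comp_mulN u K hK hcov hG hsm hgc D hfree K' hcov' hG'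
      hsm' hgc' hfree' Φ pol.lam hlam h4 pol.nonempty_unitHatSlice_iso
    rw [← hpolB] at hb
    exact IsLambdaOfAt.pullback_pow_witness_of_comp_eq_comp_mulN (B := A) (A' := A.quotientBy u K hcov hG hsm hgc)
      (show A.X ⟶ (A.quotientBy u K hcov hG hsm hgc).X from A.quotientMk u K hcov) D
      (A.dualPairOfQuotientRigidified u K hK hcov hG hsm hgc D hfree K' hcov' hG' hsm' hgc' hfree' Φ h4) t polB.lam hb hΘ₀

end AbelianSchemeOver

end Literature.AlgebraicGeometry.AbelianSchemes

end
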